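import Mathlib
import Summits.Ventures.PercRepro2.Defs
import Summits.Ventures.PercRepro2.Graph
import Summits.Ventures.PercRepro2.Harris
import Summits.Ventures.PercRepro2.Exploration
import Summits.Ventures.PercRepro2.Events

/-!
# Row 2′C1 ⟸ the `G − o` form (★) (blind cell PercRepro2, p2 g32; proofs/P2-G32-STAR.md §1–§2)

Notation: `Q = {a₁ ↮ a₂}`, `U = C(a₁) ∪ C(a₂)`, `K_i = C_{G−o}(a_i)` (clusters after closing every
edge at `o`, `connDelEvent ends {o}`), `F₂ = {b ∉ K₂}`, `F = {b ∉ K₁ ∪ K₂}`.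

**(★)** (`StarNonneg`, a CONJECTURE of the cell: 0 exact violations on 63,653 random instances
n 5–7 and 53,045 ratio-maximising descents, kit j331934):

  `P(Q, o ∈ U, F) · P(Q) ≤ P(Q, o ∈ U) · P(Q, F₂)`,

i.e. `Cov_μ(1[o ∈ U], 1[b ∉ K₂]) ≤ μ(o ∈ U, b ∈ K₁)` — the row with the clusters `(H, L)` replaced
by the `G − o` clusters `(K₂, K₁)`.  `c1_of_star`: (★) ⟹ row 2′C1, by event inclusion alone:
`row − (★) = P(Q)·P(Q, oU, F, b ∈ U) − P(Q, oU)·P(Q, b ∈ H, F) ≥ 0` because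
`{b ∈ H, F} ⊆ {o ∈ U, F, b ∈ U}` (a connection `b ↔ a₂` that is not a connection in `G − o` passes
through `o`: `conn_of_conn_of_not_connDel`).  Std axioms.
-/

namespace Summit.Ventures.PercRepro2

namespace RowC1

section Star

open Classical

variable {V : Type*} {E : Type*} [Fintype E] [DecidableEq E] [Fintype V] [DecidableEq V]
  {R : Type*} [CommRing R] [LinearOrder R] [IsStrictOrderedRing R]

omit [Fintype E] [DecidableEq E] in
/-- A chain of open edges avoiding `o` is a connection in `G − o`. -/
lemma conn_restrict_of_reflTransGen_avoid {ends : E → Sym2 V} {ω : Config E} {o u v : V}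
    (h : Relation.ReflTransGen
      (fun x y => (openGraph ends ω).Adj x y ∧ x ≠ o ∧ y ≠ o) u v) :
    Conn ends (restrict (touches ends (↑({o} : Finset V) : Set V))ᶜ ω) u v := by
  induction h with
  | refl => exact conn_refl _ _ _
  | @tail x y _ hxy ih =>
    obtain ⟨hadj, hx, hy⟩ := hxy
    refine conn_trans ih ?_
    obtain ⟨hne, e, he, hends⟩ := openGraph_adj.1 hadj
    refine SimpleGraph.Adj.reachable (openGraph_adj.2 ⟨hne, e, ?_, hends⟩)
    refine restrict_eq_true_iff.2 ⟨he, ?_⟩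
    rintro ⟨z, hz, y', hz'⟩
    rw [Finset.coe_singleton, Set.mem_singleton_iff] at hz
    subst hz
    rw [hends] at hz'
    rcases Sym2.eq_iff.1 hz' with ⟨h1, _⟩ | ⟨_, h2⟩
    · exact hx h1
    · exact hy h2

omit [Fintype E] [DecidableEq E] in
/-- **A connection that is not a connection in `G − o` passes through `o`**:
`u ↔ w` and `¬ (u ↔ w in G − o)` give `o ↔ w`. -/
lemma conn_of_conn_of_not_connDel {ends : E → Sym2 V} {ω : Config E} {o u w : V}
    (h : Conn ends ω u w)
    (hdel : ¬ Conn ends (restrict (touches ends (↑({o} : Finset V) : Set V))ᶜ ω) u w) :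
    Conn ends ω o w := by
  have key : ∀ v, Relation.ReflTransGen (openGraph ends ω).Adj u v →
      Relation.ReflTransGen
        (fun x y => (openGraph ends ω).Adj x y ∧ x ≠ o ∧ y ≠ o) u v ∨ Conn ends ω o v := by
    intro v hv
    induction hv with
    | refl => exact Or.inl Relation.ReflTransGen.refl
    | @tail x y _ hxy ih =>
      rcases ih with h1 | h1
      · by_cases hx : x = o
        · subst hx
          exact Or.inr hxy.reachable
        · by_cases hy : y = o
          · subst hy
            exact Or.inr (conn_refl _ _ _)
          · exact Or.inl (h1.tail ⟨hxy, hx, hy⟩)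
      · exact Or.inr (conn_trans h1 hxy.reachable)
  rcases key w ((SimpleGraph.reachable_iff_reflTransGen _ _).1 h) with h1 | h1
  · exact absurd (conn_restrict_of_reflTransGen_avoid h1) hdel
  · exact h1

/-- **(★), the `G − o` form of row 2′C1** (a Prop):
`P(Q, o ∈ U, b ∉ K₁ ∪ K₂) · P(Q) ≤ P(Q, o ∈ U) · P(Q, b ∉ K₂)`, with `K_i = C_{G−o}(a_i)`. -/
def StarNonneg (p : E → R) (ends : E → Sym2 V) (a₁ a₂ o b : V) : Prop :=
  prob p ((connEvent ends a₁ o ∪ connEvent ends a₂ o) ∩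
      ((connDelEvent ends {o} b a₁)ᶜ ∩ (connDelEvent ends {o} b a₂)ᶜ) ∩
      (connEvent ends a₁ a₂)ᶜ) *
    prob p (connEvent ends a₁ a₂)ᶜ ≤
  prob p ((connEvent ends a₁ o ∪ connEvent ends a₂ o) ∩ (connEvent ends a₁ a₂)ᶜ) *
    prob p ((connDelEvent ends {o} b a₂)ᶜ ∩ (connEvent ends a₁ a₂)ᶜ)

/-- **Row 2′C1 from (★)**: `P(Q, b ∈ H) · P(Q, o ∈ U) ≤ P(Q) · P(Q, o ∈ U, b ∈ U)`
(the conclusion of `c1_of_lpart`, verbatim). -/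
theorem c1_of_star (p : E → R) (hp : IsProbVec p) (ends : E → Sym2 V) (a₁ a₂ o b : V)
    (hS : StarNonneg p ends a₁ a₂ o b) :
    prob p (connEvent ends a₂ b ∩ (connEvent ends a₁ a₂)ᶜ) *
      prob p ((connEvent ends a₁ o ∪ connEvent ends a₂ o) ∩ (connEvent ends a₁ a₂)ᶜ) ≤
    prob p (connEvent ends a₁ a₂)ᶜ *
      prob p ((connEvent ends a₁ o ∪ connEvent ends a₂ o) ∩
        (connEvent ends a₁ b ∪ connEvent ends a₂ b) ∩ (connEvent ends a₁ a₂)ᶜ) := by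
  unfold StarNonneg at hS
  set Q : Set (Config E) := (connEvent ends a₁ a₂)ᶜ with hQ
  set oU : Set (Config E) := connEvent ends a₁ o ∪ connEvent ends a₂ o with hoU
  set bU : Set (Config E) := connEvent ends a₁ b ∪ connEvent ends a₂ b with hbU
  set bH : Set (Config E) := connEvent ends a₂ b with hbH
  set F₂ : Set (Config E) := (connDelEvent ends {o} b a₂)ᶜ with hF₂
  set F : Set (Config E) := (connDelEvent ends {o} b a₁)ᶜ ∩ (connDelEvent ends {o} b a₂)ᶜ with hF
  -- (i) `b ∉ U ⊆ F`
  have hbUF : bUᶜ ⊆ F := by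
    intro ω hω
    simp only [hbU, Set.mem_compl_iff, Set.mem_union, not_or] at hω
    refine ⟨fun h => hω.1 ?_, fun h => hω.2 ?_⟩
    · exact conn_symm (connDelEvent_subset_connEvent ends {o} b a₁ h)
    · exact conn_symm (connDelEvent_subset_connEvent ends {o} b a₂ h)
  -- (ii) `F₂ᶜ ⊆ bH`
  have hF₂bH : F₂ᶜ ⊆ bH := by
    intro ω hω
    simp only [hF₂, compl_compl] at hω
    exact conn_symm (connDelEvent_subset_connEvent ends {o} b a₂ hω)
  -- (iii) the inclusion `{Q, b ∈ H, F₂} ⊆ {Q, o ∈ U, F, b ∈ U}`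
  have hinc : bH ∩ F₂ ∩ Q ⊆ oU ∩ F ∩ bU ∩ Q := by
    intro ω hω
    obtain ⟨⟨hbHω, hF₂ω⟩, hQω⟩ := hω
    have hbH' : Conn ends ω a₂ b := hbHω
    have hF₂' : ¬ Conn ends (restrict (touches ends (↑({o} : Finset V) : Set V))ᶜ ω) b a₂ := hF₂ω
    have hQ' : ¬ Conn ends ω a₁ a₂ := hQω
    have ho : Conn ends ω o a₂ := conn_of_conn_of_not_connDel (conn_symm hbH') hF₂'
    refine ⟨⟨⟨?_, ?_, hF₂ω⟩, ?_⟩, hQω⟩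
    · exact Or.inr (conn_symm ho)
    · intro h
      have hb1 : Conn ends ω a₁ b := conn_symm (connDelEvent_subset_connEvent ends {o} b a₁ h)
      exact hQ' (conn_trans hb1 (conn_symm hbH'))
    · exact Or.inr hbH'
  -- masses
  have hpart1 := prob_inter_add_prob_inter_compl p (oU ∩ F ∩ Q) bU
  have hpart2 := prob_inter_add_prob_inter_compl p (oU ∩ Q) bU
  have hpart3 := prob_inter_add_prob_inter_compl p Q F₂
  have hpart4 := prob_inter_add_prob_inter_compl p (bH ∩ Q) F₂
  have hset1 : oU ∩ F ∩ Q ∩ bUᶜ = oU ∩ Q ∩ bUᶜ := by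
    ext ω
    simp only [Set.mem_inter_iff, Set.mem_compl_iff]
    constructor
    · rintro ⟨⟨⟨h1, _⟩, h3⟩, h4⟩
      exact ⟨⟨h1, h3⟩, h4⟩
    · rintro ⟨⟨h1, h3⟩, h4⟩
      exact ⟨⟨⟨h1, hbUF h4⟩, h3⟩, h4⟩
  have hset2 : bH ∩ Q ∩ F₂ᶜ = Q ∩ F₂ᶜ := by
    ext ω
    simp only [Set.mem_inter_iff]
    constructor
    · rintro ⟨⟨_, h2⟩, h3⟩
      exact ⟨h2, h3⟩
    · rintro ⟨h2, h3⟩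
      exact ⟨⟨hF₂bH h3, h2⟩, h3⟩
  have hset3 : oU ∩ F ∩ Q ∩ bU = oU ∩ F ∩ bU ∩ Q := by
    ext ω
    simp only [Set.mem_inter_iff]
    tauto
  have hset4 : bH ∩ Q ∩ F₂ = bH ∩ F₂ ∩ Q := by
    ext ω
    simp only [Set.mem_inter_iff]
    tauto
  have hset5 : oU ∩ Q ∩ bU = oU ∩ bU ∩ Q := by
    ext ω
    simp only [Set.mem_inter_iff]
    tauto
  have hset6 : Q ∩ F₂ = F₂ ∩ Q := Set.inter_comm _ _
  rw [hset3, hset1] at hpart1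
  rw [hset5] at hpart2
  rw [hset6] at hpart3
  rw [hset4, hset2] at hpart4
  have hmono1 : prob p (bH ∩ F₂ ∩ Q) ≤ prob p (oU ∩ F ∩ bU ∩ Q) := prob_mono hp hinc
  have hmono2 : prob p (oU ∩ Q) ≤ prob p Q := prob_mono hp Set.inter_subset_right
  have hn1 : 0 ≤ prob p (bH ∩ F₂ ∩ Q) := prob_nonneg hp _
  have hprod : prob p (oU ∩ Q) * prob p (bH ∩ F₂ ∩ Q) ≤
      prob p Q * prob p (oU ∩ F ∩ bU ∩ Q) := mul_le_mul hmono2 hmono1 hn1 (prob_nonneg hp _)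
  have e1 : prob p (bH ∩ Q) * prob p (oU ∩ Q) =
      prob p (bH ∩ F₂ ∩ Q) * prob p (oU ∩ Q) + prob p (Q ∩ F₂ᶜ) * prob p (oU ∩ Q) := by
    rw [← hpart4]; ring
  have e2 : prob p Q * prob p (oU ∩ bU ∩ Q) =
      prob p Q * prob p (oU ∩ Q) - prob p Q * prob p (oU ∩ Q ∩ bUᶜ) := by
    rw [← hpart2]; ring
  have e3 : prob p Q * prob p (oU ∩ F ∩ bU ∩ Q) =
      prob p Q * prob p (oU ∩ F ∩ Q) - prob p Q * prob p (oU ∩ Q ∩ bUᶜ) := by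
    rw [← hpart1]; ring
  have e4 : prob p (oU ∩ Q) * prob p (F₂ ∩ Q) =
      prob p (oU ∩ Q) * prob p Q - prob p (oU ∩ Q) * prob p (Q ∩ F₂ᶜ) := by
    rw [← hpart3]; ring
  nlinarith [hS, hprod, e1, e2, e3, e4]

end Star

end RowC1

end Summit.Ventures.PercRepro2
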